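import Literature.NumberTheory.QuadraticForms.HasseInvariantFrames
import HarnessLib

/-!
# Hasse products of block-diagonal frames

Topic `NumberTheory/QuadraticForms`; namespace `Literature.NumberTheory.QuadraticForms`. Everything
here is proved; pure bookkeeping with an abstract Hasse symbol `s` (`IsHasseSymbol`) and the
Hasse product `hasseProd s a = ∏_{i<j} s (a i) (a j)` of `HasseInvariantFrames.lean`.

The `2`-adic frames of an even unimodular lattice come in binary blocks diagonalised over `ℚ` as
`⟨αₖ, αₖβₖ⟩` (`αₖ = 2Aₖ`, `βₖ = -Dₖ`; Serre, *A Course in Arithmetic*, Ch. V §1.3.6). For the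
frame listing first all `αₖ` and then all `αₖβₖ` (`Fin.append α (α * β)`) we compute
(`hasseProd_append_mul_self`):

  `∏_{i<j} s(Nᵢ, Nⱼ) = s(∏ α, ∏ α) · ∏ₖ s(αₖ, βₖ) · ∏_{k<l} s(βₖ, βₗ)`,

by the rules `ε(x ⊕ y) = ε(x) ε(y) ∏ᵢⱼ s(xᵢ, yⱼ)` (`hasseProd_append`),
`ε(a b) = ε(a) ε(b) ∏_{i<j} s(aᵢ,bⱼ) s(bᵢ,aⱼ)` (`hasseProd_mul`), `∏ᵢ∏ⱼ s(aᵢ,bⱼ) = s(∏a, ∏b)` and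
`ε² = 1` — the standard manipulations of Hasse invariants of orthogonal sums (Serre, Ch. IV §2.1;
compare the formula `ε(f ∔ g) = ε(f)ε(g)(d(f), d(g))`).

## References

* J.-P. Serre, *A Course in Arithmetic*, GTM 7, Springer 1973, Ch. IV §2.1 (PDF pp. 33–34),
  Ch. V §1.3.6 (PDF p. 46). [Serre1973]
-/

namespace Literature.NumberTheory.QuadraticForms

open Finset

variable {K : Type*} [Field K] {s : K → K → ℤ}

/-- `∏ᵢ ∏ⱼ s(aᵢ, bⱼ) = s(∏ a, ∏ b)` for a Hasse symbol on non-zero families. [cite: Serre1973, Ch. IV §2.1] -/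
theorem prod_prod_symbol (hs : IsHasseSymbol s) {k l : ℕ} (a : Fin k → K) (b : Fin l → K)
    (ha : ∀ i, a i ≠ 0) (hb : ∀ j, b j ≠ 0) :
    ∏ i, ∏ j, s (a i) (b j) = s (∏ i, a i) (∏ j, b j) := by
  have hB : (∏ j, b j) ≠ 0 := prod_ne_zero_iff.mpr fun j _ => hb j
  calc ∏ i, ∏ j, s (a i) (b j) = ∏ i, s (a i) (∏ j, b j) :=
        prod_congr rfl fun i _ => (hs.map_prod_right _ (ha i) b hb).symm
    _ = ∏ i, s (∏ j, b j) (a i) := prod_congr rfl fun i _ => hs.comm _ _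
    _ = s (∏ j, b j) (∏ i, a i) := (hs.map_prod_right _ hB a ha).symm
    _ = s (∏ i, a i) (∏ j, b j) := hs.comm _ _

/-- A Hasse product squares to `1` (its factors are `±1`). [cite: Serre1973, Ch. IV §2.1] -/
theorem hasseProd_mul_self (hs : IsHasseSymbol s) {k : ℕ} (a : Fin k → K) (ha : ∀ i, a i ≠ 0) :
    hasseProd s a * hasseProd s a = 1 := by
  unfold hasseProd
  rw [← prod_mul_distrib]
  refine prod_eq_one fun i _ => ?_
  rw [← prod_mul_distrib]
  refine prod_eq_one fun j _ => ?_
  split_ifs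
  · exact hs.mul_self _ _ (ha i) (ha j)
  · rfl

omit [Field K] in
/-- **Hasse product of a concatenation**: `ε(x ⊕ y) = ε(x) · ∏ᵢⱼ s(xᵢ, yⱼ) · ε(y)` (the cross
pairs all have the `x`-index first). [cite: Serre1973, Ch. IV §2.1] -/
theorem hasseProd_append {k l : ℕ} (x : Fin k → K) (y : Fin l → K) :
    hasseProd s (Fin.append x y) = hasseProd s x * (∏ i, ∏ j, s (x i) (y j)) * hasseProd s y := by
  unfold hasseProd
  rw [Fin.prod_univ_add]
  simp only [Fin.append_left, Fin.append_right]
  have h1 : ∀ i : Fin k, (∏ j : Fin (k + l), if Fin.castAdd l i < j then s (x i) (Fin.append x y j)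
      else 1) = (∏ i', if i < i' then s (x i) (x i') else 1) * ∏ j, s (x i) (y j) := by
    intro i
    have hA : (∏ i' : Fin k, if Fin.castAdd l i < Fin.castAdd l i' then s (x i) (x i') else 1) =
        ∏ i', if i < i' then s (x i) (x i') else 1 :=
      prod_congr rfl fun i' _ => by simp only [Fin.lt_def, Fin.val_castAdd]
    have hC : (∏ j : Fin l, if Fin.castAdd l i < Fin.natAdd k j then s (x i) (y j) else 1) =
        ∏ j, s (x i) (y j) :=
      prod_congr rfl fun j _ => if_pos (Fin.lt_def.mpr (by
        simp only [Fin.val_castAdd, Fin.val_natAdd]; omega))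
    rw [Fin.prod_univ_add]
    simp only [Fin.append_left, Fin.append_right]
    rw [hA, hC]
  have h2 : ∀ j : Fin l, (∏ j' : Fin (k + l), if Fin.natAdd k j < j' then s (y j) (Fin.append x y j')
      else 1) = ∏ j', if j < j' then s (y j) (y j') else 1 := by
    intro j
    have hA : (∏ i : Fin k, if Fin.natAdd k j < Fin.castAdd l i then s (y j) (x i) else 1) = 1 :=
      prod_eq_one fun i _ => if_neg fun h => by
        rw [Fin.lt_def, Fin.val_natAdd, Fin.val_castAdd] at h
        omega
    have hC : (∏ j' : Fin l, if Fin.natAdd k j < Fin.natAdd k j' then s (y j) (y j') else 1) =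
        ∏ j', if j < j' then s (y j) (y j') else 1 :=
      prod_congr rfl fun j' _ => by simp only [Fin.lt_def, Fin.val_natAdd, add_lt_add_iff_left]
    rw [Fin.prod_univ_add]
    simp only [Fin.append_left, Fin.append_right]
    rw [hA, hC, one_mul]
  rw [prod_congr rfl fun i _ => h1 i, prod_congr rfl fun j _ => h2 j, prod_mul_distrib]

/-- **Hasse product of a pointwise product**:
`ε(a b) = ε(a) ε(b) ∏_{i<j} s(aᵢ, bⱼ) s(bᵢ, aⱼ)`. [cite: Serre1973, Ch. IV §2.1] -/
theorem hasseProd_mul (hs : IsHasseSymbol s) {k : ℕ} (a b : Fin k → K) (ha : ∀ i, a i ≠ 0)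
    (hb : ∀ i, b i ≠ 0) :
    hasseProd s (a * b) = hasseProd s a * hasseProd s b *
      ∏ i, ∏ j, if i < j then s (a i) (b j) * s (b i) (a j) else 1 := by
  unfold hasseProd
  rw [← prod_mul_distrib, ← prod_mul_distrib]
  refine prod_congr rfl fun i _ => ?_
  rw [← prod_mul_distrib, ← prod_mul_distrib]
  refine prod_congr rfl fun j _ => ?_
  split_ifs
  · rw [Pi.mul_apply, Pi.mul_apply, hs.mul_left _ _ _ (ha i) (hb i) (mul_ne_zero (ha j) (hb j)),
      hs.mul_right _ _ _ (ha i) (ha j) (hb j), hs.mul_right _ _ _ (hb i) (ha j) (hb j)]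
    ring
  · simp

/-- Ordered pairs split into `i < j`, `j < i` and `i = j`:
`(∏_{i<j} F i j · F j i) · ∏ᵢ F i i = ∏ᵢ ∏ⱼ F i j`. [folklore] -/
theorem prod_prod_eq_offDiag_mul_diag {M : Type*} [CommMonoid M] {k : ℕ} (F : Fin k → Fin k → M) :
    (∏ i, ∏ j, if i < j then F i j * F j i else 1) * ∏ i, F i i = ∏ i, ∏ j, F i j := by
  have hsplit : ∀ i j, F i j = (if i < j then F i j else 1) * (if j < i then F i j else 1) *
      (if i = j then F i j else 1) := by
    intro i j
    rcases lt_trichotomy i j with h | h | h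
    · rw [if_pos h, if_neg (not_lt.mpr h.le), if_neg h.ne]; simp
    · subst h; simp
    · rw [if_neg (not_lt.mpr h.le), if_pos h, if_neg h.ne']; simp
  have e1 : ∏ i, ∏ j, F i j = (∏ i : Fin k, ∏ j : Fin k, if i < j then F i j else 1) *
      (∏ i : Fin k, ∏ j : Fin k, if j < i then F i j else 1) *
      ∏ i : Fin k, ∏ j : Fin k, if i = j then F i j else 1 :=
    calc ∏ i, ∏ j, F i j = ∏ i, ∏ j, ((if i < j then F i j else 1) * (if j < i then F i j else 1) *
          (if i = j then F i j else 1)) :=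
        prod_congr rfl fun i _ => prod_congr rfl fun j _ => hsplit i j
      _ = ∏ i, ((∏ j, if i < j then F i j else 1) * (∏ j, if j < i then F i j else 1) *
          ∏ j, if i = j then F i j else 1) :=
        prod_congr rfl fun i _ => by rw [prod_mul_distrib, prod_mul_distrib]
      _ = _ := by rw [prod_mul_distrib, prod_mul_distrib]
  have hcomm : (∏ i : Fin k, ∏ j : Fin k, if j < i then F i j else 1) =
      ∏ i : Fin k, ∏ j : Fin k, if i < j then F j i else 1 := prod_comm
  have hdiag : (∏ i : Fin k, ∏ j : Fin k, if i = j then F i j else 1) = ∏ i, F i i := by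
    refine prod_congr rfl fun i _ => ?_
    rw [prod_ite_eq]; simp
  have e3 : (∏ i, ∏ j, if i < j then F i j * F j i else 1) =
      (∏ i : Fin k, ∏ j : Fin k, if i < j then F i j else 1) *
        ∏ i : Fin k, ∏ j : Fin k, if i < j then F j i else 1 :=
    calc (∏ i, ∏ j, if i < j then F i j * F j i else 1)
        = ∏ i, ∏ j, ((if i < j then F i j else 1) * (if i < j then F j i else 1)) :=
          prod_congr rfl fun i _ => prod_congr rfl fun j _ => by split_ifs <;> simp
      _ = ∏ i, ((∏ j, if i < j then F i j else 1) * ∏ j, if i < j then F j i else 1) :=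
          prod_congr rfl fun i _ => prod_mul_distrib
      _ = _ := prod_mul_distrib
  rw [e3, e1, hcomm, hdiag]

/-- **Hasse product of a frame in binary blocks `⟨αₖ, αₖβₖ⟩`**: for non-zero `α β : Fin m → K`,
`ε(α ⊕ αβ) = s(∏α, ∏α) · ∏ₖ s(αₖ, βₖ) · ε(β)`. With `αₖ = 2Aₖ`, `βₖ = -Dₖ` this evaluates `ε₂` of an
even unimodular lattice from its `2`-adic blocks (Serre, Ch. V §1.3.6). [cite: Serre1973, Ch. IV §2.1] -/
theorem hasseProd_append_mul_self (hs : IsHasseSymbol s) {m : ℕ} (α β : Fin m → K)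
    (hα : ∀ k, α k ≠ 0) (hβ : ∀ k, β k ≠ 0) :
    hasseProd s (Fin.append α (α * β)) =
      s (∏ k, α k) (∏ k, α k) * (∏ k, s (α k) (β k)) * hasseProd s β := by
  have hαβ : ∀ k, (α * β) k ≠ 0 := fun k => mul_ne_zero (hα k) (hβ k)
  have hA : (∏ k, α k) ≠ 0 := prod_ne_zero_iff.mpr fun k _ => hα k
  have hBn : (∏ k, β k) ≠ 0 := prod_ne_zero_iff.mpr fun k _ => hβ k
  -- the cross term `∏ᵢⱼ s(αᵢ, αⱼβⱼ) = s(A, A) s(A, B)`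
  have hX : (∏ i, ∏ j, s (α i) ((α * β) j)) = s (∏ k, α k) (∏ k, α k) * s (∏ k, α k) (∏ k, β k) := by
    rw [prod_prod_symbol hs α (α * β) hα hαβ]
    rw [show (∏ j, (α * β) j) = (∏ k, α k) * ∏ k, β k from by
      simp only [Pi.mul_apply]; exact prod_mul_distrib]
    exact hs.mul_right _ _ _ hA hA hBn
  -- the off-diagonal term
  have hZ : (∏ i, ∏ j, if i < j then s (α i) (β j) * s (β i) (α j) else 1) =
      s (∏ k, α k) (∏ k, β k) * ∏ k, s (α k) (β k) := by
    have h := prod_prod_eq_offDiag_mul_diag fun i j => s (α i) (β j)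
    rw [prod_prod_symbol hs α β hα hβ] at h
    have h' : (∏ i, ∏ j, if i < j then s (α i) (β j) * s (β i) (α j) else 1) =
        ∏ i, ∏ j, if i < j then s (α i) (β j) * s (α j) (β i) else 1 := by
      refine prod_congr rfl fun i _ => prod_congr rfl fun j _ => ?_
      rw [hs.comm (β i) (α j)]
    rw [h', ← h, mul_assoc, ← prod_mul_distrib,
      prod_eq_one (fun k _ => hs.mul_self _ _ (hα k) (hβ k)), mul_one]
  rw [hasseProd_append, hasseProd_mul hs α β hα hβ, hX, hZ]
  -- `ε(α)² = 1`, `s(A,B)² = 1`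
  have h1 := hasseProd_mul_self hs α hα
  have h2 := hs.mul_self (∏ k, α k) (∏ k, β k) hA hBn
  calc hasseProd s α * (s (∏ k, α k) (∏ k, α k) * s (∏ k, α k) (∏ k, β k)) *
        (hasseProd s α * hasseProd s β * (s (∏ k, α k) (∏ k, β k) * ∏ k, s (α k) (β k)))
      = (hasseProd s α * hasseProd s α) * (s (∏ k, α k) (∏ k, β k) * s (∏ k, α k) (∏ k, β k)) *
          (s (∏ k, α k) (∏ k, α k) * (∏ k, s (α k) (β k)) * hasseProd s β) := by ring
    _ = s (∏ k, α k) (∏ k, α k) * (∏ k, s (α k) (β k)) * hasseProd s β := by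
        rw [h1, h2]; ring

end Literature.NumberTheory.QuadraticForms
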